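import Summits.HodgeConjecture.HodgeConjecture.Theorems.PadicSemiregularLiftFormalVectorBundlesAlgebraizeCokernelRestrict
import Summits.HodgeConjecture.HodgeConjecture.Theorems.PadicSemiregularLiftFormalVectorBundlesAlgebraizePullbackUnitSections
import Literature.AlgebraicGeometry.Modules.IsoOfSectionsOnBasis

/-!
# Isogeny bounds along a cospan of local isomorphisms; pull-back of a morphism invertible over an open

Helper file toward the crux `PadicSemiregularLift.FormalVectorBundlesAlgebraize`
(stmt-HodgeConjecture-14106), proper case via a Chow cover. For the unit `η : M → ρ_*ρ^*M` of a
module `M` which is only LOCALLY of a known shape `A` (on an open `V`: global morphisms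
`φ₁ : A → J ← M : φ₂` bijective on the sections over every open `W ≤ V`) the two isogeny bounds
"`η(s) = 0 ⇒ b s = 0`" and "`b t` is locally in the image of `η`" pass from `η_A` to `η_M` over the
opens `W ≤ V` (`kerBound_of_cospan`, `cokerBound_of_cospan`), for ANY natural transformation
`η : 𝟭 → R`, provided `R φ₁`, `R φ₂` are still injective / bijective on sections over the opens
`W ≤ V`. For `R = ρ_* ∘ ρ^*` this last proviso is supplied by
`pullback_map_app_bijective_of_le`: **a morphism of `𝒪_Y`-modules which is bijective on the
sections over the affine opens `W ≤ V` has a pull-back `ρ^*φ` bijective on the sections over all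
opens `W' ≤ ρ⁻¹V`** (restriction to the open subscheme `V` is an isomorphism, and pull-back commutes
with restriction: `isIso_restrict_pullback_map` of `…AlgebraizePullbackUnitSections`).

Everything is proved; no definitions.
-/

set_option linter.dupNamespace false

noncomputable section

-- Summit.HodgeConjecture.HodgeConjecture.… repeats the summit name by the D-0017 layout (Sub = Summit).

-- `TopCat.Presheaf`/`Scheme.Modules` are not reducible (as in Mathlib's `AlgebraicGeometry/Modules`).
set_option backward.isDefEq.respectTransparency false

open CategoryTheory CategoryTheory.Limits AlgebraicGeometry TopologicalSpace Opposite
open Literature.AlgebraicGeometry.Modules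
open Literature.AlgebraicGeometry.Motives (Scheme.Modules.Hom.app_map_apply)

universe u

namespace Summit.HodgeConjecture.HodgeConjecture.Theorems.FormalVectorBundlesAlgebraize

/-! ### Transfer of the bounds along a cospan `A → J ← M` of local isomorphisms -/

section Cospan

variable {X : Scheme.{u}} (R : X.Modules ⥤ X.Modules) (η : 𝟭 X.Modules ⟶ R) (b : Γ(X, ⊤))
  (V : X.Opens) {A J M : X.Modules} (φ₁ : A ⟶ J) (φ₂ : M ⟶ J)

/-- Naturality of `η` on sections: `(R φ)(η_A q) = η_J(φ q)`. -/
theorem map_app_unit_app {A J : X.Modules} (φ : A ⟶ J) (W : X.Opens) (q : Γ(A, W)) :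
    (R.map φ).app W ((η.app A).app W q) = (η.app J).app W (φ.app W q) := by
  have h := η.naturality φ
  rw [Functor.id_map] at h
  have h' := congrArg (fun ψ => (Scheme.Modules.Hom.app ψ W) q) h
  simp only [Scheme.Modules.Hom.comp_app] at h'
  exact h'.symm

/-- **Kernel bound along a cospan.** If `φ₁ : A → J` and `φ₂ : M → J` are bijective on the sections
over every open `W ≤ V`, `R φ₁` is injective there, and every section of `A` over `W ≤ V` killed by
`η_A` is killed by `b`, then every section of `M` over `W ≤ V` killed by `η_M` is killed by `b`. -/
theorem kerBound_of_cospan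
    (h₁ : ∀ W : X.Opens, W ≤ V → Function.Bijective (φ₁.app W))
    (h₂ : ∀ W : X.Opens, W ≤ V → Function.Injective (φ₂.app W))
    (hR₁ : ∀ W : X.Opens, W ≤ V → Function.Injective ((R.map φ₁).app W))
    (hK : ∀ (W : X.Opens), W ≤ V → ∀ q : Γ(A, W), (η.app A).app W q = 0 →
      X.presheaf.map (homOfLE (le_top : W ≤ ⊤)).op b • q = 0)
    (W : X.Opens) (hW : W ≤ V) (s : Γ(M, W)) (hs : (η.app M).app W s = 0) :
    X.presheaf.map (homOfLE (le_top : W ≤ ⊤)).op b • s = 0 := by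
  obtain ⟨q, hq⟩ := (h₁ W hW).2 (φ₂.app W s)
  -- `η_A q = 0`: check after `R φ₁`, where it becomes `η_J (φ₂ s) = (R φ₂)(η_M s) = 0`
  have hq0 : (η.app A).app W q = 0 := by
    apply hR₁ W hW
    rw [map_zero, map_app_unit_app, hq, ← map_app_unit_app, hs, map_zero]
  apply h₂ W hW
  rw [map_zero, Scheme.Modules.Hom.app_smul, ← hq, ← Scheme.Modules.Hom.app_smul, hK W hW q hq0,
    map_zero]

/-- **Cokernel bound along a cospan.** If `φ₂ : M → J` is bijective on the sections over every open
`W ≤ V`, `R φ₁` is bijective and `R φ₂` injective there, and for every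
section `t` of `R A` over `W ≤ V` the multiple `b t` is locally in the image of `η_A`, then the same
holds for `M`. -/
theorem cokerBound_of_cospan
    (h₂ : ∀ W : X.Opens, W ≤ V → Function.Bijective (φ₂.app W))
    (hR₁ : ∀ W : X.Opens, W ≤ V → Function.Bijective ((R.map φ₁).app W))
    (hR₂ : ∀ W : X.Opens, W ≤ V → Function.Injective ((R.map φ₂).app W))
    (hC : ∀ (W : X.Opens), W ≤ V → ∀ (t : Γ(R.obj A, W)) (x : X), x ∈ W →
      ∃ (W' : X.Opens) (hW' : W' ≤ W), x ∈ W' ∧ ∃ q : Γ(A, W'), (η.app A).app W' q =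
        (R.obj A).presheaf.map (homOfLE hW').op (X.presheaf.map (homOfLE (le_top : W ≤ ⊤)).op b • t))
    (W : X.Opens) (hW : W ≤ V) (t : Γ(R.obj M, W)) (x : X) (hx : x ∈ W) :
    ∃ (W' : X.Opens) (hW' : W' ≤ W), x ∈ W' ∧ ∃ s : Γ(M, W'), (η.app M).app W' s =
      (R.obj M).presheaf.map (homOfLE hW').op (X.presheaf.map (homOfLE (le_top : W ≤ ⊤)).op b • t) := by
  -- move `t` to `R A`
  obtain ⟨t₂, ht₂⟩ := (hR₁ W hW).2 ((R.map φ₂).app W t)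
  obtain ⟨W', hW', hxW', q, hq⟩ := hC W hW t₂ x hx
  obtain ⟨s, hs⟩ := (h₂ W' (hW'.trans hW)).2 (φ₁.app W' q)
  refine ⟨W', hW', hxW', s, ?_⟩
  apply hR₂ W' (hW'.trans hW)
  rw [map_app_unit_app, hs, ← map_app_unit_app, hq, Scheme.Modules.Hom.app_map_apply,
    Scheme.Modules.Hom.app_smul, ht₂, ← Scheme.Modules.Hom.app_smul, ← Scheme.Modules.Hom.app_map_apply]

end Cospan

/-! ### Morphisms invertible over an open, and their pull-backs -/

section OverOpen

variable {X : Scheme.{u}} (V : X.Opens) {A B : X.Modules} (φ : A ⟶ B)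

/-- A morphism bijective on the sections over the affine opens `W ≤ V` restricts to an isomorphism on
the open subscheme `V`. -/
theorem isIso_restrict_of_bijective
    (h : ∀ W : X.Opens, W ≤ V → IsAffineOpen W → Function.Bijective (φ.app W)) :
    IsIso ((Scheme.Modules.restrictFunctor V.ι).map φ) := by
  refine isIso_of_bijective_app_of_isAffineOpen _ fun O hO => ?_
  have e : ∀ y, ((Scheme.Modules.restrictFunctor V.ι).map φ).app O y =
      φ.app (V.ι ''ᵁ O) (show Γ(A, V.ι ''ᵁ O) from y) := fun y => restrictFunctor_map_app' V φ O y
  have hb := h (V.ι ''ᵁ O) (V.ι_image_le O) (hO.image_of_isOpenImmersion V.ι)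
  exact ⟨fun y y' hyy' => hb.1 (by rw [← e, ← e, hyy']), fun z => by
    obtain ⟨y, hy⟩ := hb.2 z; exact ⟨y, (e y).trans hy⟩⟩

/-- Bijective on the sections over the affine opens `W ≤ V` ⇒ bijective on the sections over all
opens `W ≤ V`. -/
theorem app_bijective_of_bijective_affine
    (h : ∀ W : X.Opens, W ≤ V → IsAffineOpen W → Function.Bijective (φ.app W))
    (W : X.Opens) (hW : W ≤ V) : Function.Bijective (φ.app W) :=
  haveI := isIso_restrict_of_bijective V φ h
  app_bijective_of_isIso_restrict V φ hW

variable {Y : Scheme.{u}} (ρ : Y ⟶ X)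

/-- **A morphism bijective on the sections over the affine opens `W ≤ V` pulls back to a morphism
bijective on the sections over all opens `W' ≤ ρ⁻¹V`.** -/
theorem pullback_map_app_bijective_of_le
    (h : ∀ W : X.Opens, W ≤ V → IsAffineOpen W → Function.Bijective (φ.app W))
    (W' : Y.Opens) (hW' : W' ≤ ρ ⁻¹ᵁ V) :
    Function.Bijective (((Scheme.Modules.pullback ρ).map φ).app W') := by
  haveI := isIso_restrict_of_bijective V φ h
  haveI := isIso_restrict_pullback_map ρ V φ
  exact app_bijective_of_isIso_restrict (ρ ⁻¹ᵁ V) _ hW'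

/-- The same for `ρ_*ρ^*φ` on the sections over the opens `W ≤ V`. -/
theorem pushforward_pullback_map_app_bijective_of_le
    (h : ∀ W : X.Opens, W ≤ V → IsAffineOpen W → Function.Bijective (φ.app W))
    (W : X.Opens) (hW : W ≤ V) :
    Function.Bijective (((Scheme.Modules.pullback ρ ⋙ Scheme.Modules.pushforward ρ).map φ).app W) :=
  pullback_map_app_bijective_of_le V φ ρ h (ρ ⁻¹ᵁ W) (ρ.preimage_mono hW)

end OverOpen

end Summit.HodgeConjecture.HodgeConjecture.Theorems.FormalVectorBundlesAlgebraize

end
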